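import Mathlib
import Literature.MathematicalPhysics.StatisticalMechanics.LennardJonesClusters
import Literature.MathematicalPhysics.StatisticalMechanics.Yuhjtman2015Proofs
import HarnessLib

/-!
# Force balance at a pair in a Lennard-Jones ground state

Stub `stub_forceBalance` of line `Sketch`, crux `LjLaminarWindows` (stmt-AtomisticToContinuum-6711).

For a Lennard-Jones ground state `x : Fin N → ℝ³` and particles `p ≠ q` at distance `a`, with
Yuhjtman's minus-energy `h = hLJ = -12 V_LJ` and `h'(r) = 12r⁻¹³ - 12r⁻⁷ = -12 V_LJ'(r)`:

* removal + insertion next to an extreme particle (`forceBalance_one_le_sum_hLJ`):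
  `∑_{k ≠ p} h(r_{pk}) ≥ 1`;
* criticality of the energy in the position of `x_p` (`forceBalance_isLocalMin`,
  `forceBalance_sum_deriv_eq_zero`): `∑_{k ≠ p} V_LJ'(r_{pk}) ⟪x_p - x_k, e⟫ / r_{pk} = 0` for every
  direction `e`; with `e = x_q - x_p` and Cauchy–Schwarz, `h'(a) ≤ ∑_{k ≠ p, q} |h'(r_{pk})|`;
* adding `t ≥ 0` times the second to the first:
  `1 - h(a) + t h'(a) ≤ ∑_{k ≠ p, q} (h(r_{pk}) + t |h'(r_{pk})|)` (`stub_forceBalance`).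
-/

noncomputable section

open scoped BigOperators InnerProductSpace
open Filter Topology
open Literature.MathematicalPhysics.StatisticalMechanics
open Literature.MathematicalPhysics.StatisticalMechanics.Yuhjtman2015

namespace Summit.AtomisticToContinuum.Crystallization.Theorems.LjLaminarWindowsSketch

/-! ## One-variable derivatives -/

/-- `V_LJ` is differentiable away from `0`, with `V_LJ'(r) = -r⁻¹³ + r⁻⁷ = -(1/12)·h'(r)`,
`h'(r) = 12r⁻¹³ - 12r⁻⁷`. [folklore] -/
theorem forceBalance_hasDerivAt_lennardJones {r : ℝ} (hr : r ≠ 0) :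
    HasDerivAt lennardJones (-(1 / 12) * (12 * r⁻¹ ^ 13 - 12 * r⁻¹ ^ 7)) r := by
  have hi : HasDerivAt (fun y : ℝ ↦ y⁻¹) (-(r ^ 2)⁻¹) r := hasDerivAt_inv hr
  have h := ((hi.fun_pow 12).const_mul (1 / 12 : ℝ)).fun_sub ((hi.fun_pow 6).const_mul (1 / 6 : ℝ))
  refine h.congr_deriv ?_
  push_cast
  ring

/-- Along a line, `d/ds ‖w + s·e‖ = ⟪w, e⟫/‖w‖` at `s = 0`, for `w ≠ 0`. [folklore] -/
theorem forceBalance_hasDerivAt_norm_add_smul {F : Type*} [NormedAddCommGroup F]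
    [InnerProductSpace ℝ F] {w : F} (e : F) (hw : w ≠ 0) :
    HasDerivAt (fun s : ℝ => ‖w + s • e‖) (⟪w, e⟫_ℝ / ‖w‖) 0 := by
  have h1 : HasDerivAt (fun s : ℝ => w + s • e) e 0 := by
    simpa using ((hasDerivAt_id (0 : ℝ)).smul_const e).const_add w
  have h2 : HasDerivAt (fun s : ℝ => ‖w + s • e‖ ^ 2) (2 * ⟪w, e⟫_ℝ) 0 := by
    have := h1.norm_sq
    simpa using this
  have h0 : ‖w + (0 : ℝ) • e‖ ^ 2 ≠ 0 := by
    rw [zero_smul, add_zero]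
    exact pow_ne_zero 2 (norm_ne_zero_iff.2 hw)
  have h3 := h2.sqrt h0
  have h4 : (fun s : ℝ => √(‖w + s • e‖ ^ 2)) = fun s => ‖w + s • e‖ :=
    funext fun s => Real.sqrt_sq (norm_nonneg _)
  rw [h4] at h3
  convert h3 using 1
  rw [zero_smul, add_zero, Real.sqrt_sq (norm_nonneg _)]
  field_simp

/-! ## Variations of one particle in a ground state -/

/-- **Variation of one particle.** In a Lennard-Jones ground state, moving particle `p` to a
point `y` avoiding the other particles does not decrease the energy:
`𝓔ᵖ(x) ≤ ∑_{k ≠ p} V_LJ(|y - x_k|)`. [folklore] -/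
theorem forceBalance_siteEnergy_le_sum {d N : ℕ} {x : Fin N → EuclideanSpace ℝ (Fin d)}
    (hx : IsGroundState lennardJones x) (p : Fin N) {y : EuclideanSpace ℝ (Fin d)}
    (hy : ∀ k, k ≠ p → y ≠ x k) :
    siteEnergy lennardJones x p ≤ ∑ k ∈ Finset.univ.erase p, lennardJones (dist y (x k)) := by
  have hinj : Function.Injective (Function.update x p y) := by
    intro a b hab
    by_cases ha : a = p <;> by_cases hb : b = p
    · exact ha.trans hb.symm
    · subst ha
      rw [Function.update_self, Function.update_of_ne hb] at hab
      exact absurd hab (hy b hb)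
    · subst hb
      rw [Function.update_self, Function.update_of_ne ha] at hab
      exact absurd hab.symm (hy a ha)
    · rw [Function.update_of_ne ha, Function.update_of_ne hb] at hab
      exact hx.1 hab
  have hle : interactionEnergy lennardJones x ≤
      interactionEnergy lennardJones (Function.update x p y) := by
    rw [hx.2]
    exact groundStateEnergy_lennardJones_le hinj
  have hdiff := sum_siteEnergy_update_sub lennardJones x p y
  have h2 := two_mul_interactionEnergy lennardJones x
  have h2' := two_mul_interactionEnergy lennardJones (Function.update x p y)
  linarith

/-- **Removal + insertion.** In a Lennard-Jones ground state with at least two particles,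
`∑_{k ≠ p} h(|x_p - x_k|) ≥ 1` (`h = hLJ = -12 V_LJ`): move `x_p` to `y = x_m + e₀`, where `x_m`
(`m ≠ p`) has the largest first coordinate among the other particles and `e₀` is the first unit
vector; then `|y - x_m| = 1` (`V_LJ = -1/12`) and `|y - x_k|² ≥ 1 + |x_m - x_k|² ≥ 1` for
`k ≠ p` (`V_LJ ≤ 0`), so `𝓔ᵖ(x) ≤ -1/12`. [folklore] -/
theorem forceBalance_one_le_sum_hLJ {N : ℕ} {x : Fin N → EuclideanSpace ℝ (Fin 3)}
    (hx : IsGroundState lennardJones x) {p q : Fin N} (hpq : p ≠ q) :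
    1 ≤ ∑ k ∈ Finset.univ.erase p, hLJ (dist (x p) (x k)) := by
  set e₀ : EuclideanSpace ℝ (Fin 3) := EuclideanSpace.single 0 1 with he₀
  have hne : (Finset.univ.erase p).Nonempty :=
    ⟨q, Finset.mem_erase.2 ⟨hpq.symm, Finset.mem_univ _⟩⟩
  obtain ⟨m, hm, hmax⟩ :=
    Finset.exists_max_image (Finset.univ.erase p) (fun k => ⟪x k, e₀⟫_ℝ) hne
  set y : EuclideanSpace ℝ (Fin 3) := x m + e₀ with hy
  have he₀n : ‖e₀‖ = 1 := by simp [he₀]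
  -- every other particle is at distance `≥ 1` from `y`
  have hdist : ∀ k ∈ Finset.univ.erase p, 1 ≤ dist y (x k) := by
    intro k hk
    have hk' : ⟪x k, e₀⟫_ℝ ≤ ⟪x m, e₀⟫_ℝ := hmax k hk
    have h1 : dist y (x k) ^ 2 = ‖x m - x k‖ ^ 2 + 2 * ⟪x m - x k, e₀⟫_ℝ + 1 := by
      rw [dist_eq_norm, hy, show x m + e₀ - x k = (x m - x k) + e₀ by abel, norm_add_sq_real,
        he₀n]
      ring
    have h2 : 0 ≤ ⟪x m - x k, e₀⟫_ℝ := by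
      rw [inner_sub_left]
      linarith
    have h3 : 1 ≤ dist y (x k) ^ 2 := by nlinarith [sq_nonneg ‖x m - x k‖]
    exact (one_le_sq_iff₀ dist_nonneg).1 h3
  have hy' : ∀ k, k ≠ p → y ≠ x k := fun k hk h => by
    have := hdist k (Finset.mem_erase.2 ⟨hk, Finset.mem_univ _⟩)
    rw [h, dist_self] at this
    norm_num at this
  have hle := forceBalance_siteEnergy_le_sum hx p hy'
  -- the site energy of the inserted particle is `≤ -1/12`
  have hmterm : lennardJones (dist y (x m)) = -1 / 12 := by
    rw [hy, dist_eq_norm, add_sub_cancel_left, he₀n, lennardJones_one]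
  have hsum : ∑ k ∈ Finset.univ.erase p, lennardJones (dist y (x k)) ≤ -1 / 12 := by
    rw [← Finset.add_sum_erase _ _ hm, hmterm]
    have : ∑ k ∈ (Finset.univ.erase p).erase m, lennardJones (dist y (x k)) ≤ 0 :=
      Finset.sum_nonpos fun k hk => lennardJones_nonpos (hdist k (Finset.mem_of_mem_erase hk))
    linarith
  have hsite : siteEnergy lennardJones x p =
      -(1 / 12) * ∑ k ∈ Finset.univ.erase p, hLJ (dist (x p) (x k)) := by
    simp only [siteEnergy, lennardJones_eq_hLJ, Finset.mul_sum]
  rw [hsite] at hle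
  linarith

/-- **Criticality.** In a Lennard-Jones ground state, the energy of particle `p` displaced to
`x_p + s e`, `φ(s) = ∑_{k ≠ p} V_LJ(|x_p + s e - x_k|)`, has a local minimum at `s = 0` (for
small `|s|` the displaced particle still avoids the others, and `φ(s) - φ(0)` is the change of
the total energy). [folklore] -/
theorem forceBalance_isLocalMin {d N : ℕ} {x : Fin N → EuclideanSpace ℝ (Fin d)}
    (hx : IsGroundState lennardJones x) (p : Fin N) (e : EuclideanSpace ℝ (Fin d)) :
    IsLocalMin (fun s : ℝ => ∑ k ∈ Finset.univ.erase p,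
      lennardJones (dist (x p + s • e) (x k))) 0 := by
  -- for `s` near `0` the displaced particle avoids all the others
  have hev : ∀ᶠ s in 𝓝 (0 : ℝ), ∀ k, k ≠ p → x p + s • e ≠ x k := by
    refine Filter.eventually_all.2 fun k => ?_
    by_cases hk : k = p
    · exact Filter.Eventually.of_forall fun s h => (h hk).elim
    · have hcont : Continuous fun s : ℝ => x p + s • e := by fun_prop
      have h0 : x p + (0 : ℝ) • e ≠ x k := by
        rw [zero_smul, add_zero]
        exact hx.1.ne (Ne.symm hk)
      exact (hcont.continuousAt.eventually_ne h0).mono fun s hs _ => hs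
  refine hev.mono fun s hs => ?_
  have h := forceBalance_siteEnergy_le_sum hx p hs
  simpa [siteEnergy] using h

/-- **Force balance.** In a Lennard-Jones ground state the total force on each particle
vanishes: for every vector `e`, `∑_{k ≠ p} V_LJ'(r_k) ⟪x_p - x_k, e⟫ / r_k = 0`,
`r_k = |x_p - x_k|`, `V_LJ'(r) = -(1/12)(12r⁻¹³ - 12r⁻⁷)` (Fermat at the local minimum `s = 0`
of `φ`). [folklore] -/
theorem forceBalance_sum_deriv_eq_zero {d N : ℕ} {x : Fin N → EuclideanSpace ℝ (Fin d)}
    (hx : IsGroundState lennardJones x) (p : Fin N) (e : EuclideanSpace ℝ (Fin d)) :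
    ∑ k ∈ Finset.univ.erase p,
      -(1 / 12) * (12 * (dist (x p) (x k))⁻¹ ^ 13 - 12 * (dist (x p) (x k))⁻¹ ^ 7) *
        (⟪x p - x k, e⟫_ℝ / dist (x p) (x k)) = 0 := by
  refine (forceBalance_isLocalMin hx p e).hasDerivAt_eq_zero ?_
  refine HasDerivAt.fun_sum fun k hk => ?_
  have hkp : k ≠ p := Finset.ne_of_mem_erase hk
  have hw : x p - x k ≠ 0 := sub_ne_zero.2 (hx.1.ne (Ne.symm hkp))
  have h1 : HasDerivAt (fun s : ℝ => ‖(x p - x k) + s • e‖) (⟪x p - x k, e⟫_ℝ / ‖x p - x k‖) 0 :=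
    forceBalance_hasDerivAt_norm_add_smul e hw
  have h2 : HasDerivAt lennardJones
      (-(1 / 12) * (12 * ‖x p - x k‖⁻¹ ^ 13 - 12 * ‖x p - x k‖⁻¹ ^ 7))
      ‖(x p - x k) + (0 : ℝ) • e‖ := by
    rw [zero_smul, add_zero]
    exact forceBalance_hasDerivAt_lennardJones (norm_ne_zero_iff.2 hw)
  have h3 := h2.comp (0 : ℝ) h1
  rw [dist_eq_norm (x p) (x k)]
  refine h3.congr_of_eventuallyEq (Filter.Eventually.of_forall fun s => ?_)
  show lennardJones (dist (x p + s • e) (x k)) = lennardJones ‖x p - x k + s • e‖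
  rw [dist_eq_norm, show x p + s • e - x k = x p - x k + s • e from by abel]

/-! ## The inequality -/

/-- **Force balance at a pair.** For a Lennard-Jones ground state `x` and particles `p ≠ q` at
distance `a`, with `h = hLJ` (minus-energy) and `h'(r) = 12r⁻¹³ - 12r⁻⁷`: removal + insertion
next to an extreme particle give `∑_{k ≠ p} h(r_{pk}) ≥ 1`; criticality of the energy in `x_p`
gives `∑_{k ≠ p} h'(r_{pk}) û_k = 0`, whose `û_q`-component is bounded by Cauchy–Schwarz; for
`t ≥ 0` the two combine to `1 - h(a) + t h'(a) ≤ ∑_{k ≠ p,q} (h(r_{pk}) + t |h'(r_{pk})|)`.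
[folklore] -/
theorem stub_forceBalance :
    ∀ (N : ℕ) (x : Fin N → EuclideanSpace ℝ (Fin 3)), IsGroundState lennardJones x →
      ∀ p q : Fin N, p ≠ q → ∀ t : ℝ, 0 ≤ t →
        1 - hLJ (dist (x p) (x q)) +
            t * (12 * (dist (x p) (x q))⁻¹ ^ 13 - 12 * (dist (x p) (x q))⁻¹ ^ 7) ≤
          ∑ k ∈ (Finset.univ.erase p).erase q,
            (hLJ (dist (x p) (x k)) +
              t * |12 * (dist (x p) (x k))⁻¹ ^ 13 - 12 * (dist (x p) (x k))⁻¹ ^ 7|) := by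
  intro N x hx p q hpq t ht
  have hq : q ∈ Finset.univ.erase p := Finset.mem_erase.2 ⟨hpq.symm, Finset.mem_univ _⟩
  set a : ℝ := dist (x p) (x q) with ha_def
  have ha : 0 < a := dist_pos.2 (hx.1.ne hpq)
  -- (i) removal + insertion
  have hins := forceBalance_one_le_sum_hLJ hx hpq
  rw [← Finset.add_sum_erase _ _ hq] at hins
  -- (ii) force balance in the direction `e = x_q - x_p`
  set e : EuclideanSpace ℝ (Fin 3) := x q - x p with he_def
  have hen : ‖e‖ = a := by rw [he_def, ← dist_eq_norm, dist_comm]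
  have hbal := forceBalance_sum_deriv_eq_zero hx p e
  rw [← Finset.add_sum_erase _ _ hq] at hbal
  have hqin : ⟪x p - x q, e⟫_ℝ = -a ^ 2 := by
    rw [show x p - x q = -e by rw [he_def]; abel, inner_neg_left, real_inner_self_eq_norm_sq, hen]
  rw [hqin] at hbal
  -- Cauchy–Schwarz for the other terms
  have hT : ∀ k ∈ (Finset.univ.erase p).erase q,
      -(-(1 / 12) * (12 * (dist (x p) (x k))⁻¹ ^ 13 - 12 * (dist (x p) (x k))⁻¹ ^ 7) *
          (⟪x p - x k, e⟫_ℝ / dist (x p) (x k))) ≤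
        a / 12 * |12 * (dist (x p) (x k))⁻¹ ^ 13 - 12 * (dist (x p) (x k))⁻¹ ^ 7| := by
    intro k hk
    have hkp : k ≠ p := Finset.ne_of_mem_erase (Finset.mem_of_mem_erase hk)
    have hrk : 0 < dist (x p) (x k) := dist_pos.2 (hx.1.ne (Ne.symm hkp))
    have hcs : |⟪x p - x k, e⟫_ℝ / dist (x p) (x k)| ≤ a := by
      rw [abs_div, abs_of_pos hrk, div_le_iff₀ hrk]
      calc |⟪x p - x k, e⟫_ℝ| ≤ ‖x p - x k‖ * ‖e‖ := abs_real_inner_le_norm _ _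
        _ = a * dist (x p) (x k) := by rw [dist_eq_norm, hen, mul_comm]
    calc -(-(1 / 12) * (12 * (dist (x p) (x k))⁻¹ ^ 13 - 12 * (dist (x p) (x k))⁻¹ ^ 7) *
          (⟪x p - x k, e⟫_ℝ / dist (x p) (x k)))
        = 1 / 12 * ((12 * (dist (x p) (x k))⁻¹ ^ 13 - 12 * (dist (x p) (x k))⁻¹ ^ 7) *
          (⟪x p - x k, e⟫_ℝ / dist (x p) (x k))) := by ring
      _ ≤ 1 / 12 * |(12 * (dist (x p) (x k))⁻¹ ^ 13 - 12 * (dist (x p) (x k))⁻¹ ^ 7) *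
          (⟪x p - x k, e⟫_ℝ / dist (x p) (x k))| := by gcongr; exact le_abs_self _
      _ = 1 / 12 * (|12 * (dist (x p) (x k))⁻¹ ^ 13 - 12 * (dist (x p) (x k))⁻¹ ^ 7| *
          |⟪x p - x k, e⟫_ℝ / dist (x p) (x k)|) := by rw [abs_mul]
      _ ≤ 1 / 12 * (|12 * (dist (x p) (x k))⁻¹ ^ 13 - 12 * (dist (x p) (x k))⁻¹ ^ 7| * a) := by
          gcongr
      _ = a / 12 * |12 * (dist (x p) (x k))⁻¹ ^ 13 - 12 * (dist (x p) (x k))⁻¹ ^ 7| := by ring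
  have hsumT := Finset.sum_le_sum hT
  rw [Finset.sum_neg_distrib, ← Finset.mul_sum] at hsumT
  -- `h'(a) ≤ ∑ |h'(r_k)|`
  have hforce : 12 * a⁻¹ ^ 13 - 12 * a⁻¹ ^ 7 ≤
      ∑ k ∈ (Finset.univ.erase p).erase q,
        |12 * (dist (x p) (x k))⁻¹ ^ 13 - 12 * (dist (x p) (x k))⁻¹ ^ 7| := by
    have hq' : -(1 / 12) * (12 * a⁻¹ ^ 13 - 12 * a⁻¹ ^ 7) * (-a ^ 2 / a) =
        a / 12 * (12 * a⁻¹ ^ 13 - 12 * a⁻¹ ^ 7) := by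
      have hq'' : -a ^ 2 / a = -a := by rw [neg_div, pow_two, mul_self_div_self]
      rw [hq'']
      ring
    rw [hq'] at hbal
    have h12 : 0 < a / 12 := by positivity
    refine le_of_mul_le_mul_left ?_ h12
    linarith
  -- (iii) combine
  have htforce := mul_le_mul_of_nonneg_left hforce ht
  rw [Finset.mul_sum] at htforce
  rw [Finset.sum_add_distrib]
  linarith
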